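import Mathlib
import Summits.CriticalPhenomena.Ising3DConformalLimit.Theorems.PrecisionLaplacianEtaBoundsTransferTrig
import Summits.CriticalPhenomena.Ising3DConformalLimit.Theorems.PrecisionLaplacianEtaBoundsTransferIntegral
import HarnessLib

/-!
# TwoPointSpineGlue (route PrecisionLaplacian, item stmt-CriticalPhenomena-4805) — Dirichlet kernels of cubes:
# block weights, rescaled limits, and the dominating function

Helper file 14 (inputs of the block scaling limit `…TwoPointSpineGlueBlockLimit`):

* `W_cube_eq` — `∑_{u,u' ∈ Λ_M} cos(k·(x + u − u')) = cos(k·x) (∏_j D_M(k_j))²`;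
* `tendsto_inv_mul_dirichletRowSum` — `N⁻¹ D_{⌊δN⌋}(θ/N) → 2 sin(δθ)/θ` (`θ ≠ 0`), from the closed form
  `2 sin(t/2) D_M(t) = 2 sin((M+½)t)` and `sin x / x → 1` (`tendsto_sin_div`);
* `abs_inv_mul_dirichletRowSum_le` — `|N⁻¹ D_M(θ/N)| ≤ min(2δ+1, π/|θ|)` for `M ≤ δN`, `|θ| ≤ Nπ`;
* `integrable_blockMajorant`, `rpow_mul_min_sq_le_majorant` — the coordinatewise majorant
  `m(t) = c² 𝟙_{[-π,π]}|t|^{-α/3} + π² 2^{2+α/3}(1+|t|)^{-(2+α/3)}` dominates `|t|^{-α/3} min(c, π/|t|)²` and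
  `∏_j m(κ_j)` is integrable on `ℝ³`.

No definitions are introduced.
-/

noncomputable section

namespace Summit.CriticalPhenomena.Ising3DConformalLimit.Theorems.SpineGlue

open Finset Real Filter Topology MeasureTheory Literature.Probability.LatticeModels
open Literature.Barriers.CriticalPhenomena Literature.Barriers.CriticalPhenomena.SpreadOutIsing
open Summit.CriticalPhenomena.Ising3DConformalLimit.Theorems.EtaBoundsTransfer
open scoped BigOperators

/-! ### The block weight of a pair of cubes -/

/-- **The block weight of the cubes `x + Λ_M` and `Λ_M`**:
`∑_{u,u' ∈ Λ_M} cos(k·(x + u − u')) = cos(k·x) (∏_j D_M(k_j))²`. -/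
theorem W_cube_eq (M : ℕ) (k : Fin 3 → ℝ) (x : Site 3) :
    ∑ u ∈ box 3 M, ∑ u' ∈ box 3 M, Real.cos (phase 3 k (x + u - u'))
      = Real.cos (phase 3 k x) * (∏ j : Fin 3, dirichletRowSum M (k j)) ^ 2 := by
  have h1 : ∀ u u' : Site 3, Real.cos (phase 3 k (x + u - u'))
      = Real.cos (phase 3 k x) * Real.cos (phase 3 k u - phase 3 k u')
        - Real.sin (phase 3 k x) * Real.sin (phase 3 k u - phase 3 k u') := by
    intro u u'
    rw [phase_sub, phase_add, show phase 3 k x + phase 3 k u - phase 3 k u'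
      = phase 3 k x + (phase 3 k u - phase 3 k u') by ring, Real.cos_add]
  simp_rw [h1, Finset.sum_sub_distrib, ← Finset.mul_sum]
  have hsin : ∑ u ∈ box 3 M, ∑ u' ∈ box 3 M, Real.sin (phase 3 k u - phase 3 k u') = 0 := by
    have hanti : ∑ u ∈ box 3 M, ∑ u' ∈ box 3 M, Real.sin (phase 3 k u - phase 3 k u')
        = -∑ u ∈ box 3 M, ∑ u' ∈ box 3 M, Real.sin (phase 3 k u - phase 3 k u') := by
      conv_lhs => rw [Finset.sum_comm]
      rw [← Finset.sum_neg_distrib]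
      refine Finset.sum_congr rfl fun u _ => ?_
      rw [← Finset.sum_neg_distrib]
      refine Finset.sum_congr rfl fun u' _ => ?_
      rw [← Real.sin_neg, neg_sub]
    linarith
  have hcos : ∑ u ∈ box 3 M, ∑ u' ∈ box 3 M, Real.cos (phase 3 k u - phase 3 k u')
      = (∏ j : Fin 3, dirichletRowSum M (k j)) ^ 2 := by
    rw [← sum_box_box_cos_phase_sub M k]
    refine Finset.sum_congr rfl fun u _ => Finset.sum_congr rfl fun u' _ => ?_
    rw [phase_sub]
  rw [hsin, hcos, mul_zero, sub_zero]

/-! ### The rescaled Dirichlet kernel -/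

/-- `sin t / t → 1` as `t → 0`, `t ≠ 0`. -/
theorem tendsto_sin_div : Tendsto (fun t : ℝ => Real.sin t / t) (𝓝[≠] 0) (𝓝 1) := by
  have h := (Real.hasDerivAt_sin 0).tendsto_slope_zero
  simp only [zero_add, Real.sin_zero, sub_zero, Real.cos_zero, smul_eq_mul] at h
  refine h.congr' (eventually_nhdsWithin_of_forall fun t _ => ?_)
  simp only [div_eq_inv_mul]

/-- **The rescaled Dirichlet kernel converges**: `N⁻¹ D_{⌊δN⌋}(θ/N) → 2 sin(δθ)/θ` for `θ ≠ 0`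
(closed form `D_M(t) = sin((M+½)t)/sin(t/2)` and `sin x ∼ x`). -/
theorem tendsto_inv_mul_dirichletRowSum {δ θ : ℝ} (hδ : 0 < δ) (hθ : θ ≠ 0) :
    Tendsto (fun N : ℕ => (N : ℝ)⁻¹ * dirichletRowSum ⌊δ * N⌋₊ (θ / N)) atTop
      (𝓝 (2 * Real.sin (δ * θ) / θ)) := by
  -- the half-angle `h_N = θ/(2N) → 0`, `≠ 0`
  have hh : Tendsto (fun N : ℕ => θ / (2 * N)) atTop (𝓝 0) := by
    have : Tendsto (fun N : ℕ => θ / 2 * (N : ℝ)⁻¹) atTop (𝓝 (θ / 2 * 0)) :=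
      (tendsto_inv_atTop_zero.comp tendsto_natCast_atTop_atTop).const_mul _
    rw [mul_zero] at this
    refine this.congr' ?_
    filter_upwards [eventually_ge_atTop 1] with N hN
    field_simp
  have hh' : Tendsto (fun N : ℕ => θ / (2 * N)) atTop (𝓝[≠] 0) := by
    refine tendsto_nhdsWithin_iff.2 ⟨hh, ?_⟩
    filter_upwards [eventually_ge_atTop 1] with N hN
    have : (0 : ℝ) < N := by exact_mod_cast hN
    exact div_ne_zero hθ (by positivity)
  have hsinc : Tendsto (fun N : ℕ => Real.sin (θ / (2 * N)) / (θ / (2 * N))) atTop (𝓝 1) :=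
    tendsto_sin_div.comp hh'
  -- the numerator `sin((M+½)θ/N) → sin(δθ)`
  have hfrac : Tendsto (fun N : ℕ => ((⌊δ * N⌋₊ : ℝ) + 1 / 2) * (θ / N)) atTop (𝓝 (δ * θ)) := by
    -- `(⌊δN⌋ + ½)/N → δ`
    have h1 : Tendsto (fun N : ℕ => ((⌊δ * N⌋₊ : ℝ) + 1 / 2) / N) atTop (𝓝 δ) := by
      refine tendsto_of_tendsto_of_tendsto_of_le_of_le' (g := fun N : ℕ => δ - (N : ℝ)⁻¹ / 2)
        (h := fun N : ℕ => δ + (N : ℝ)⁻¹ / 2) ?_ ?_ ?_ ?_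
      · have : Tendsto (fun N : ℕ => δ - (N : ℝ)⁻¹ / 2) atTop (𝓝 (δ - 0 / 2)) :=
          tendsto_const_nhds.sub ((tendsto_inv_atTop_zero.comp tendsto_natCast_atTop_atTop).div_const 2)
        simpa using this
      · have : Tendsto (fun N : ℕ => δ + (N : ℝ)⁻¹ / 2) atTop (𝓝 (δ + 0 / 2)) :=
          tendsto_const_nhds.add ((tendsto_inv_atTop_zero.comp tendsto_natCast_atTop_atTop).div_const 2)
        simpa using this
      · filter_upwards [eventually_ge_atTop 1] with N hN
        have hN : (0 : ℝ) < N := by exact_mod_cast hN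
        have hfl : δ * N - 1 ≤ (⌊δ * N⌋₊ : ℝ) := by
          have := Nat.lt_floor_add_one (δ * N)
          linarith
        rw [le_div_iff₀ hN]
        field_simp
        nlinarith
      · filter_upwards [eventually_ge_atTop 1] with N hN
        have hN : (0 : ℝ) < N := by exact_mod_cast hN
        have hfl : (⌊δ * N⌋₊ : ℝ) ≤ δ * N := Nat.floor_le (by positivity)
        rw [div_le_iff₀ hN]
        have : (δ + (N : ℝ)⁻¹ / 2) * N = δ * N + 1 / 2 := by field_simp
        rw [this]
        linarith
    have := h1.mul_const θ
    refine this.congr' ?_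
    filter_upwards [eventually_ge_atTop 1] with N hN
    field_simp
  have hnum : Tendsto (fun N : ℕ => Real.sin (((⌊δ * N⌋₊ : ℝ) + 1 / 2) * (θ / N))) atTop
      (𝓝 (Real.sin (δ * θ))) := (Real.continuous_sin.tendsto _).comp hfrac
  -- assemble: `N⁻¹ D = sin((M+½)t) / (N sin(t/2))` and `N sin(t/2) = (θ/2) · sinc`
  have hkey : ∀ᶠ N : ℕ in atTop, (N : ℝ)⁻¹ * dirichletRowSum ⌊δ * N⌋₊ (θ / N)
      = Real.sin (((⌊δ * N⌋₊ : ℝ) + 1 / 2) * (θ / N)) /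
          ((θ / 2) * (Real.sin (θ / (2 * N)) / (θ / (2 * N)))) := by
    have hsmall : ∀ᶠ N : ℕ in atTop, |θ / (2 * N)| < π := by
      have := hh.abs
      rw [abs_zero] at this
      exact this.eventually (gt_mem_nhds Real.pi_pos)
    filter_upwards [eventually_ge_atTop 1, hsmall] with N hN hNπ
    have hNr : (0 : ℝ) < N := by exact_mod_cast hN
    have hne : θ / (2 * N) ≠ 0 := div_ne_zero hθ (by positivity)
    have hsin : Real.sin (θ / (2 * N)) ≠ 0 := by
      intro h0
      rw [Real.sin_eq_zero_iff_of_lt_of_lt (by linarith [(abs_lt.1 hNπ).1]) (abs_lt.1 hNπ).2] at h0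
      exact hne h0
    have hD := two_mul_sin_mul_dirichletRowSum ⌊δ * N⌋₊ (θ / N)
    have ht2 : θ / N / 2 = θ / (2 * N) := by field_simp
    rw [ht2] at hD
    have hD' : dirichletRowSum ⌊δ * N⌋₊ (θ / N)
        = Real.sin (((⌊δ * N⌋₊ : ℝ) + 1 / 2) * (θ / N)) / Real.sin (θ / (2 * N)) := by
      rw [eq_div_iff hsin]
      linarith
    rw [hD']
    field_simp
  have hlim : Tendsto (fun N : ℕ => Real.sin (((⌊δ * N⌋₊ : ℝ) + 1 / 2) * (θ / N)) /
      ((θ / 2) * (Real.sin (θ / (2 * N)) / (θ / (2 * N))))) atTop (𝓝 (Real.sin (δ * θ) / (θ / 2 * 1))) :=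
    hnum.div (hsinc.const_mul _) (by simp [hθ])
  rw [show 2 * Real.sin (δ * θ) / θ = Real.sin (δ * θ) / (θ / 2 * 1) by field_simp]
  exact hlim.congr' (by filter_upwards [hkey] with N hN; rw [hN])

/-- **Uniform bound on the rescaled Dirichlet kernel**: for `N ≥ 1`, `M ≤ δN` and `|θ| ≤ Nπ`,
`|N⁻¹ D_M(θ/N)| ≤ min (2δ + 1) (π/|θ|)` (`θ ≠ 0`). -/
theorem abs_inv_mul_dirichletRowSum_le {δ θ : ℝ} {N M : ℕ} (hN : 1 ≤ N) (hM : (M : ℝ) ≤ δ * N)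
    (hθ : θ ≠ 0) (hθN : |θ| ≤ N * π) :
    |(N : ℝ)⁻¹ * dirichletRowSum M (θ / N)| ≤ min (2 * δ + 1) (π / |θ|) := by
  have hNr : (0 : ℝ) < N := by exact_mod_cast hN
  rw [abs_mul, abs_of_pos (inv_pos.2 hNr)]
  refine le_min ?_ ?_
  · have h := abs_dirichletRowSum_le M (θ / N)
    calc (N : ℝ)⁻¹ * |dirichletRowSum M (θ / N)| ≤ (N : ℝ)⁻¹ * (2 * M + 1) :=
          mul_le_mul_of_nonneg_left h (inv_nonneg.2 hNr.le)
      _ ≤ (N : ℝ)⁻¹ * (2 * (δ * N) + N) := by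
          gcongr
          exact_mod_cast hN
      _ = 2 * δ + 1 := by field_simp
  · have hθN' : |θ / N| ≤ π := by
      rw [abs_div, abs_of_pos hNr, div_le_iff₀ hNr]; linarith [mul_comm (N : ℝ) π]
    have hne : θ / N ≠ 0 := div_ne_zero hθ hNr.ne'
    have h := abs_dirichletRowSum_le_pi_div M hne hθN'
    rw [abs_div, abs_of_pos hNr] at h
    calc (N : ℝ)⁻¹ * |dirichletRowSum M (θ / N)| ≤ (N : ℝ)⁻¹ * (π / (|θ| / N)) :=
          mul_le_mul_of_nonneg_left h (inv_nonneg.2 hNr.le)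
      _ = π / |θ| := by field_simp

/-! ### The dominating function -/

/-- The coordinatewise majorant `m(t) = c 𝟙_{[-π,π]}(t)|t|^{-α/3} + π² 2^{2+α/3} (1+|t|)^{-(2+α/3)}` has an
integrable product on `ℝ³` (`0 ≤ α < 3`). -/
theorem integrable_blockMajorant {α : ℝ} (hα0 : 0 ≤ α) (hα3 : α < 3) (c : ℝ) :
    Integrable (fun κ : Fin 3 → ℝ => ∏ j, (c * (Set.Icc (-π) π).indicator (fun t => |t| ^ (-(α / 3))) (κ j)
      + π ^ 2 * 2 ^ (2 + α / 3) * (1 + |κ j|) ^ (-(2 + α / 3)))) := by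
  have hπ := Real.pi_pos
  have _h := hα0
  set m : ℝ → ℝ := fun t => c * (Set.Icc (-π) π).indicator (fun t => |t| ^ (-(α / 3))) t
      + π ^ 2 * 2 ^ (2 + α / 3) * (1 + |t|) ^ (-(2 + α / 3)) with hm
  have hm_int : Integrable m := by
    refine (Integrable.const_mul ?_ c).add (Integrable.const_mul ?_ _)
    · refine IntegrableOn.integrable_indicator ?_ measurableSet_Icc
      have hs : α / 3 < 1 := by rw [div_lt_one (by norm_num)]; exact hα3
      have h := intervalIntegrable_abs_rpow_neg hs (-π) π
      rw [intervalIntegrable_iff_integrableOn_Icc_of_le (by linarith)] at h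
      exact h
    · have h1 : (Module.finrank ℝ ℝ : ℝ) < 2 + α / 3 := by
        rw [Module.finrank_self]; push_cast; linarith [div_nonneg hα0 (by norm_num : (0:ℝ) ≤ 3)]
      have h := integrable_one_add_norm (E := ℝ) (μ := volume) h1
      exact h
  show Integrable (fun κ : Fin 3 → ℝ => ∏ j, m (κ j))
  rw [MeasureTheory.volume_pi]
  exact Integrable.fintype_prod (f := fun _ : Fin 3 => m) (fun _ => hm_int)

/-- The coordinatewise comparison: `|t|^{-α/3} min(c, π/|t|)² ≤ m(t)` for `t ≠ 0`, `c ≥ 0`. -/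
theorem rpow_mul_min_sq_le_majorant {α c t : ℝ} (hα0 : 0 ≤ α) (hc : 0 ≤ c) (ht : t ≠ 0) :
    |t| ^ (-(α / 3)) * (min c (π / |t|)) ^ 2 ≤
      c ^ 2 * (Set.Icc (-π) π).indicator (fun t => |t| ^ (-(α / 3))) t
        + π ^ 2 * 2 ^ (2 + α / 3) * (1 + |t|) ^ (-(2 + α / 3)) := by
  have hπ := Real.pi_pos
  have hta : 0 < |t| := abs_pos.2 ht
  have hA : 0 ≤ c ^ 2 * (Set.Icc (-π) π).indicator (fun t => |t| ^ (-(α / 3))) t := by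
    refine mul_nonneg (sq_nonneg _) ?_
    by_cases h : t ∈ Set.Icc (-π) π
    · rw [Set.indicator_of_mem h]; exact Real.rpow_nonneg (abs_nonneg _) _
    · rw [Set.indicator_of_notMem h]
  have hB : 0 ≤ π ^ 2 * 2 ^ (2 + α / 3) * (1 + |t|) ^ (-(2 + α / 3)) := by positivity
  rcases le_or_gt |t| π with htπ | htπ
  · -- `|t| ≤ π`: use `min ≤ c` and the indicator
    have hmem : t ∈ Set.Icc (-π) π := by rw [Set.mem_Icc, ← abs_le]; exact htπ
    have h1 : (min c (π / |t|)) ^ 2 ≤ c ^ 2 :=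
      pow_le_pow_left₀ (le_min hc (div_nonneg hπ.le hta.le)) (min_le_left _ _) 2
    calc |t| ^ (-(α / 3)) * (min c (π / |t|)) ^ 2 ≤ |t| ^ (-(α / 3)) * c ^ 2 :=
          mul_le_mul_of_nonneg_left h1 (Real.rpow_nonneg hta.le _)
      _ = c ^ 2 * (Set.Icc (-π) π).indicator (fun t => |t| ^ (-(α / 3))) t := by
          rw [Set.indicator_of_mem hmem]; ring
      _ ≤ _ := le_add_of_nonneg_right hB
  · -- `|t| > π`: use `min ≤ π/|t|` and the Japanese bracket
    have h1 : (min c (π / |t|)) ^ 2 ≤ (π / |t|) ^ 2 :=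
      pow_le_pow_left₀ (le_min hc (div_nonneg hπ.le hta.le)) (min_le_right _ _) 2
    have h2 : |t| ^ (-(α / 3)) * (π / |t|) ^ 2 = π ^ 2 * |t| ^ (-(2 + α / 3)) := by
      rw [div_pow, show -(2 + α / 3) = -(α / 3) + (-(2 : ℝ)) by ring, Real.rpow_add hta,
        Real.rpow_neg hta.le (2 : ℝ), Real.rpow_two]
      field_simp
    have h3 : |t| ^ (-(2 + α / 3)) ≤ 2 ^ (2 + α / 3) * (1 + |t|) ^ (-(2 + α / 3)) := by
      have h4 : (1 + |t|) / 2 ≤ |t| := by linarith [Real.pi_gt_three]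
      have h := Real.rpow_le_rpow_of_nonpos (by positivity : 0 < (1 + |t|) / 2) h4
        (by linarith [div_nonneg hα0 (by norm_num : (0:ℝ) ≤ 3)] : -(2 + α / 3) ≤ 0)
      rw [Real.div_rpow (by positivity) (by norm_num), Real.rpow_neg (by norm_num : (0:ℝ) ≤ 2),
        div_inv_eq_mul, mul_comm] at h
      exact h
    calc |t| ^ (-(α / 3)) * (min c (π / |t|)) ^ 2 ≤ |t| ^ (-(α / 3)) * (π / |t|) ^ 2 :=
          mul_le_mul_of_nonneg_left h1 (Real.rpow_nonneg hta.le _)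
      _ = π ^ 2 * |t| ^ (-(2 + α / 3)) := h2
      _ ≤ π ^ 2 * (2 ^ (2 + α / 3) * (1 + |t|) ^ (-(2 + α / 3))) := mul_le_mul_of_nonneg_left h3 (by positivity)
      _ = π ^ 2 * 2 ^ (2 + α / 3) * (1 + |t|) ^ (-(2 + α / 3)) := by ring
      _ ≤ _ := le_add_of_nonneg_left hA

end Summit.CriticalPhenomena.Ising3DConformalLimit.Theorems.SpineGlue

end
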